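import Summits.AtomisticToContinuum.Crystallization.Theorems.ReggeStarCoercivityDefectFreeCrystallizesDefs
import Summits.AtomisticToContinuum.Crystallization.Theorems.ChargedEnergyGap.Negative.Unconditional

/-!
# The squeeze modulo gluing, part A: budget, counting, the `o(N)` count of non-layered sites
# (line `prestress-split-korn`, block S5b; crux stmt-AtomisticToContinuum-13603)

Crux `ReggeStarCoercivity.DefectFreeCrystallizes`; registered stub
`stub_squeezeToLayered : LayeredGluing → SqueezeClosure` (proved in the sibling file
`ReggeStarCoercivityDefectFreeCrystallizesSqueezeToLayered.lean`, which imports this one). Vocabulary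
(`LayeredNear`, `SplitCoercivity`, `LayeredGluing`, `SqueezeClosure`, …) from the line's Defs file
`ReggeStarCoercivityDefectFreeCrystallizesDefs.lean`; the line's site energy is `½·siteEnergy lennardJones x i`
(Literature `siteEnergy`) and `e*` is the periodic infimum `⨅ Q, Q.energyPerParticle lennardJones`
(= `ChargedEnergyGapNegative.eStar`, `squeeze_iInf_eq_eStar` is `rfl`).

Contents (all unconditional):
* (a) budget: `squeeze_sum_half_siteEnergy` (`Σ ½𝓔ⁱ = E`, `two_mul_interactionEnergy`), `squeeze_sum_excess`,
  `squeeze_sum_excess_nonneg` (`card_mul_eStar_le`), `squeeze_tendsto_excess_div` / `squeeze_tendsto_sum_excess_div`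
  (`(E(x N) − N e*)/N → 0` along ground states, from the PROVED `crysEnergyLimit`; this is where minimality is spent);
  registered anchor `squeeze_budget_anchor`.
* (b) `squeeze_neg_le_half_siteEnergy`: `½𝓔ⁱ ≥ −(125/6)·δ⁻⁶` for `δ`-separated configurations (`sum_inv_pow_six_le`).
* (c) counting: `squeeze_card_filter_dist_le`, `squeeze_card_filter_exists_near_le`
  (`#{i : ∃ j ∈ D, |x_j − x_i| ≤ ρ} ≤ (2ρ/δ+1)³·#D`, from `card_le_of_separated_of_dist_le`), `squeeze_defects_eq_card_filter`.
* (ii) `squeeze_ineq` (one configuration, `Ω :=` the `ρ`-deep good sites) and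
  `squeeze_tendsto_card_not_layeredNear_div`: under `SplitCoercivity`, `defects/N → 0 ⇒ #{i : ¬LayeredNear η}/N → 0`
  for every `η > 0` (the charge `c(η)` is independent of the slack `θ := c·ε/4`, chosen after `c`).
-/

noncomputable section

open scoped BigOperators Classical InnerProductSpace
open Filter Topology

namespace Summit.AtomisticToContinuum.Crystallization.Theorems.PrestressSplitKorn

open Summit.AtomisticToContinuum.Crystallization.Theses
open Summit.AtomisticToContinuum.Crystallization.Theses.ReggeStarCoercivity
open Summit.AtomisticToContinuum.Crystallization.Theorems.DefectFreeCrystallizes.Negative.PredicateAPI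
open Literature.MathematicalPhysics.StatisticalMechanics Literature.Geometry.DiscreteGeometry

local notation "E3" => EuclideanSpace ℝ (Fin 3)

/-- The periodic infimum `e* = ⨅_Q e_LJ(Q)` written inline in `SplitCoercivity` is the tree's `eStar` (rfl). -/
theorem squeeze_iInf_eq_eStar :
    (⨅ Q : PeriodicConfiguration 3, Q.energyPerParticle lennardJones) = ChargedEnergyGapNegative.eStar := rfl

/-! ## (a) The energy budget of a ground-state sequence -/

section Budget

variable {N : ℕ}

/-- `Σ_i ½·𝓔ⁱ = E(x)`: the half site energies sum to the interaction energy (`two_mul_interactionEnergy`). -/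
theorem squeeze_sum_half_siteEnergy (x : Fin N → E3) :
    ∑ i, (1 / 2 : ℝ) * siteEnergy lennardJones x i = interactionEnergy lennardJones x := by
  rw [← Finset.mul_sum, ← two_mul_interactionEnergy lennardJones x]
  ring

/-- The total excess `Σ_i (½·𝓔ⁱ − e*) = E(x) − N·e*`. -/
theorem squeeze_sum_excess (x : Fin N → E3) :
    ∑ i, ((1 / 2 : ℝ) * siteEnergy lennardJones x i - ChargedEnergyGapNegative.eStar) =
      interactionEnergy lennardJones x - (N : ℝ) * ChargedEnergyGapNegative.eStar := by
  rw [Finset.sum_sub_distrib, squeeze_sum_half_siteEnergy, Finset.sum_const, Finset.card_univ,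
    Fintype.card_fin, nsmul_eq_mul]

/-- The total excess of an injective configuration is non-negative (`card_mul_eStar_le`). -/
theorem squeeze_sum_excess_nonneg {x : Fin N → E3} (hx : Function.Injective x) :
    0 ≤ ∑ i, ((1 / 2 : ℝ) * siteEnergy lennardJones x i - ChargedEnergyGapNegative.eStar) := by
  rw [squeeze_sum_excess]
  linarith [ChargedEnergyGapNegative.card_mul_eStar_le hx]

/-- **The o(N) budget, energy form**: along any sequence of Lennard-Jones ground states,
`(E(x N) − N·e*)/N → 0` (`crysEnergyLimit`: `E(N)/N → e*`; minimality enters only here and in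
`N·e* ≤ E`). -/
theorem squeeze_tendsto_excess_div (x : (N : ℕ) → (Fin N → E3))
    (hx : ∀ N, IsGroundState lennardJones (x N)) :
    Tendsto (fun N : ℕ => (interactionEnergy lennardJones (x N) -
      (N : ℝ) * (⨅ Q : PeriodicConfiguration 3, Q.energyPerParticle lennardJones)) / N) atTop (𝓝 0) := by
  have h1 : Tendsto (fun N : ℕ => groundStateEnergy lennardJones 3 N / N -
      (⨅ Q : PeriodicConfiguration 3, Q.energyPerParticle lennardJones)) atTop (𝓝 0) := by
    simpa using ChargedEnergyGapNegative.crysEnergyLimit.sub_const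
      (⨅ Q : PeriodicConfiguration 3, Q.energyPerParticle lennardJones)
  refine h1.congr' ?_
  filter_upwards [eventually_ge_atTop 1] with N hN
  have hNr : (N : ℝ) ≠ 0 := by exact_mod_cast (Nat.one_le_iff_ne_zero.1 hN)
  rw [(hx N).2]
  field_simp

/-- **The o(N) budget, site form**: `Σ_i (½·𝓔ⁱ(x N) − e*) / N → 0` along ground states. -/
theorem squeeze_tendsto_sum_excess_div (x : (N : ℕ) → (Fin N → E3))
    (hx : ∀ N, IsGroundState lennardJones (x N)) :
    Tendsto (fun N : ℕ => (∑ i, ((1 / 2 : ℝ) * siteEnergy lennardJones (x N) i -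
      ChargedEnergyGapNegative.eStar)) / N) atTop (𝓝 0) := by
  have h := squeeze_tendsto_excess_div x hx
  simp only [squeeze_sum_excess]
  exact h

end Budget

/-! ## (b) Site energies of separated configurations are bounded below -/

section SiteBound

variable {N : ℕ}

/-- `V_LJ(r) ≥ −r⁻⁶/6`. -/
theorem squeeze_neg_inv_pow_six_le_lennardJones (r : ℝ) : -(1 / 6 * r⁻¹ ^ 6) ≤ lennardJones r := by
  unfold lennardJones
  have : 0 ≤ (1 / 12 : ℝ) * r⁻¹ ^ 12 := by positivity
  linarith

/-- **Half site energies of a `δ`-separated configuration are `≥ −(125/6)·δ⁻⁶`** (shell sum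
`sum_inv_pow_six_le`). -/
theorem squeeze_neg_le_half_siteEnergy {δ : ℝ} (hδ : 0 < δ) {x : Fin N → E3}
    (hsep : ∀ i j : Fin N, i ≠ j → δ ≤ dist (x i) (x j)) (i : Fin N) :
    -(125 / 6 * δ⁻¹ ^ 6) ≤ (1 / 2 : ℝ) * siteEnergy lennardJones x i := by
  have hS := sum_inv_pow_six_le x hδ hsep i
  have h1 : ∑ j ∈ Finset.univ.erase i, -(1 / 6 * (dist (x i) (x j))⁻¹ ^ 6) ≤
      ∑ j ∈ Finset.univ.erase i, lennardJones (dist (x i) (x j)) :=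
    Finset.sum_le_sum fun j _ => squeeze_neg_inv_pow_six_le_lennardJones _
  rw [Finset.sum_neg_distrib, ← Finset.mul_sum] at h1
  unfold siteEnergy
  linarith

end SiteBound

/-! ## (c) Counting: sites near a small set are few (packing) -/

section Counting

variable {N : ℕ}

/-- A `δ`-separated configuration (`δ > 0`) is injective. -/
theorem squeeze_injective_of_separated {δ : ℝ} (hδ : 0 < δ) {x : Fin N → E3}
    (hsep : ∀ i j : Fin N, i ≠ j → δ ≤ dist (x i) (x j)) : Function.Injective x := by
  intro i j hij
  by_contra hne
  have := hsep i j hne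
  rw [hij, dist_self] at this
  linarith

/-- **Packing count**: in a `δ`-separated configuration at most `(2ρ/δ + 1)³` particles lie within
distance `ρ` of a given particle (`card_le_of_separated_of_dist_le`). -/
theorem squeeze_card_filter_dist_le {δ ρ : ℝ} (hδ : 0 < δ) (hρ : 0 ≤ ρ) {x : Fin N → E3}
    (hsep : ∀ i j : Fin N, i ≠ j → δ ≤ dist (x i) (x j)) (j : Fin N) :
    ((Finset.univ.filter fun i : Fin N => dist (x j) (x i) ≤ ρ).card : ℝ) ≤ (2 * ρ / δ + 1) ^ 3 := by
  set F := Finset.univ.filter fun i : Fin N => dist (x j) (x i) ≤ ρ with hF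
  have hinj : Set.InjOn x F := (squeeze_injective_of_separated hδ hsep).injOn
  rw [← Finset.card_image_of_injOn hinj]
  have h := card_le_of_separated_of_dist_le (F.image x) (x j) hδ hρ ?_ ?_
  · simpa [finrank_euclideanSpace_fin] using h
  · intro c hc
    obtain ⟨i, hi, rfl⟩ := Finset.mem_image.1 hc
    rw [dist_comm]
    exact (Finset.mem_filter.1 hi).2
  · intro c hc d hd hcd
    obtain ⟨i, -, rfl⟩ := Finset.mem_image.1 hc
    obtain ⟨k, -, rfl⟩ := Finset.mem_image.1 hd
    exact hsep i k fun h => hcd (h ▸ rfl)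

/-- **Sites within `ρ` of a set `D` number at most `(2ρ/δ + 1)³ · #D`** (`δ`-separated configuration). -/
theorem squeeze_card_filter_exists_near_le {δ ρ : ℝ} (hδ : 0 < δ) (hρ : 0 ≤ ρ) {x : Fin N → E3}
    (hsep : ∀ i j : Fin N, i ≠ j → δ ≤ dist (x i) (x j)) (D : Finset (Fin N)) :
    ((Finset.univ.filter fun i : Fin N => ∃ j ∈ D, dist (x j) (x i) ≤ ρ).card : ℝ) ≤
      (2 * ρ / δ + 1) ^ 3 * D.card := by
  have hsub : (Finset.univ.filter fun i : Fin N => ∃ j ∈ D, dist (x j) (x i) ≤ ρ) ⊆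
      D.biUnion fun j => Finset.univ.filter fun i : Fin N => dist (x j) (x i) ≤ ρ := by
    intro i hi
    obtain ⟨j, hj, hji⟩ := (Finset.mem_filter.1 hi).2
    exact Finset.mem_biUnion.2 ⟨j, hj, Finset.mem_filter.2 ⟨Finset.mem_univ _, hji⟩⟩
  calc ((Finset.univ.filter fun i : Fin N => ∃ j ∈ D, dist (x j) (x i) ≤ ρ).card : ℝ)
      ≤ ((D.biUnion fun j => Finset.univ.filter fun i : Fin N => dist (x j) (x i) ≤ ρ).card : ℝ) := by
        exact_mod_cast Finset.card_le_card hsub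
    _ ≤ ∑ j ∈ D, ((Finset.univ.filter fun i : Fin N => dist (x j) (x i) ≤ ρ).card : ℝ) := by
        exact_mod_cast Finset.card_biUnion_le
    _ ≤ ∑ _j ∈ D, (2 * ρ / δ + 1) ^ 3 :=
        Finset.sum_le_sum fun j _ => squeeze_card_filter_dist_le hδ hρ hsep j
    _ = (2 * ρ / δ + 1) ^ 3 * D.card := by rw [Finset.sum_const, nsmul_eq_mul, mul_comm]

/-- `defects x` is the cardinality of the finset of defective sites. -/
theorem squeeze_defects_eq_card_filter (x : Fin N → E3) :
    defects x = (Finset.univ.filter fun i : Fin N => ¬ Good x i).card := by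
  unfold defects
  rw [Nat.card_eq_fintype_card, Fintype.card_subtype]

end Counting

/-! ## (ii) The squeeze: the number of non-`η`-layered sites is `o(N)` -/

section Squeeze

variable {N : ℕ}

/-- **The squeeze inequality for one configuration.** If the coercivity inequality holds (charge `c`,
boundary constant `C`, slack `θ ≥ 0`, depth `ρ`) for every set `Ω` whose `ρ`-neighbourhoods are good, then,
applied to THE set of `ρ`-deep good sites, it bounds the number of ALL non-`η`-layered sites by the total
excess, the slack `θ·N` and a multiple of the number of defective sites (packing counts for the shallow sites
and for the boundary layer; half site energies bounded below on the shallow sites). -/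
theorem squeeze_ineq {δ η c θ ρ C : ℝ} (hδ : 0 < δ) (hρ : 0 < ρ) (hc : 0 < c) (hθ : 0 ≤ θ)
    {x : Fin N → E3} (hsep : ∀ i j : Fin N, i ≠ j → δ ≤ dist (x i) (x j))
    (hΩ : ∀ Ω : Finset (Fin N), (∀ i ∈ Ω, ∀ j : Fin N, dist (x j) (x i) ≤ ρ → Good x j) →
      c * ((Ω.filter fun i => ¬ LayeredNear η x i).card : ℝ)
          - C * ((Ω.filter fun i => ∃ j : Fin N, j ∉ Ω ∧ dist (x j) (x i) ≤ ρ).card : ℝ)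
          - θ * (Ω.card : ℝ)
        ≤ ∑ i ∈ Ω, ((1 / 2 : ℝ) * siteEnergy lennardJones x i - ChargedEnergyGapNegative.eStar)) :
    c * ((Finset.univ.filter fun i => ¬ LayeredNear η x i).card : ℝ) ≤
      (∑ i, ((1 / 2 : ℝ) * siteEnergy lennardJones x i - ChargedEnergyGapNegative.eStar)) + θ * N +
        (2 * ρ / δ + 1) ^ 3 * (max C 0 * (2 * ρ / δ + 1) ^ 3 +
          (125 / 6 * δ⁻¹ ^ 6 + |ChargedEnergyGapNegative.eStar|) + c) *
          ((Finset.univ.filter fun i => ¬ Good x i).card : ℝ) := by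
  set e : ℝ := ChargedEnergyGapNegative.eStar with he
  set M : ℝ := (2 * ρ / δ + 1) ^ 3 with hM
  set D := Finset.univ.filter fun i : Fin N => ¬ Good x i with hD
  set Ω := Finset.univ.filter fun i : Fin N => ∀ j : Fin N, dist (x j) (x i) ≤ ρ → Good x j
    with hΩdef
  have hgood : ∀ i ∈ Ω, ∀ j : Fin N, dist (x j) (x i) ≤ ρ → Good x j := fun i hi =>
    (Finset.mem_filter.1 hi).2
  have hineq := hΩ Ω hgood
  have hM0 : 0 ≤ M := by positivity
  -- the shallow sites are within `ρ` of a defective site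
  have hcompl : ((Ωᶜ).card : ℝ) ≤ M * D.card := by
    have hsub : Ωᶜ ⊆ Finset.univ.filter fun i : Fin N => ∃ j ∈ D, dist (x j) (x i) ≤ ρ := by
      intro i hi
      rw [Finset.mem_compl, hΩdef, Finset.mem_filter, not_and] at hi
      have h' := hi (Finset.mem_univ i)
      push Not at h'
      obtain ⟨j, hj, hjg⟩ := h'
      exact Finset.mem_filter.2
        ⟨Finset.mem_univ _, j, Finset.mem_filter.2 ⟨Finset.mem_univ _, hjg⟩, hj⟩
    calc ((Ωᶜ).card : ℝ)
        ≤ ((Finset.univ.filter fun i : Fin N => ∃ j ∈ D, dist (x j) (x i) ≤ ρ).card : ℝ) := by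
          exact_mod_cast Finset.card_le_card hsub
      _ ≤ M * D.card := squeeze_card_filter_exists_near_le hδ hρ.le hsep D
  -- the boundary layer of `Ω` is within `ρ` of the shallow sites
  have hbdry : ((Ω.filter fun i => ∃ j : Fin N, j ∉ Ω ∧ dist (x j) (x i) ≤ ρ).card : ℝ) ≤
      M * (M * D.card) := by
    have hsub : (Ω.filter fun i => ∃ j : Fin N, j ∉ Ω ∧ dist (x j) (x i) ≤ ρ) ⊆
        Finset.univ.filter fun i : Fin N => ∃ j ∈ Ωᶜ, dist (x j) (x i) ≤ ρ := by
      intro i hi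
      obtain ⟨-, j, hj, hji⟩ := Finset.mem_filter.1 hi
      exact Finset.mem_filter.2 ⟨Finset.mem_univ _, j, Finset.mem_compl.2 hj, hji⟩
    calc ((Ω.filter fun i => ∃ j : Fin N, j ∉ Ω ∧ dist (x j) (x i) ≤ ρ).card : ℝ)
        ≤ ((Finset.univ.filter fun i : Fin N => ∃ j ∈ Ωᶜ, dist (x j) (x i) ≤ ρ).card : ℝ) := by
          exact_mod_cast Finset.card_le_card hsub
      _ ≤ M * (Ωᶜ).card := squeeze_card_filter_exists_near_le hδ hρ.le hsep Ωᶜ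
      _ ≤ M * (M * D.card) := mul_le_mul_of_nonneg_left hcompl hM0
  -- the excess on `Ω` is at most the total excess plus `(B + |e*|)·#Ωᶜ`
  have hsum : ∑ i ∈ Ω, ((1 / 2 : ℝ) * siteEnergy lennardJones x i - e) ≤
      (∑ i, ((1 / 2 : ℝ) * siteEnergy lennardJones x i - e)) +
        (125 / 6 * δ⁻¹ ^ 6 + |e|) * (M * D.card) := by
    rw [← Finset.sum_add_sum_compl Ω (fun i => (1 / 2 : ℝ) * siteEnergy lennardJones x i - e)]
    have hlow : ∀ i ∈ Ωᶜ, -(125 / 6 * δ⁻¹ ^ 6 + |e|) ≤ (1 / 2 : ℝ) * siteEnergy lennardJones x i - e := by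
      intro i _
      have h1 := squeeze_neg_le_half_siteEnergy hδ hsep i
      have h2 := le_abs_self e
      linarith
    have h1 : ∑ _i ∈ Ωᶜ, -(125 / 6 * δ⁻¹ ^ 6 + |e|) ≤
        ∑ i ∈ Ωᶜ, ((1 / 2 : ℝ) * siteEnergy lennardJones x i - e) :=
      Finset.sum_le_sum hlow
    rw [Finset.sum_const, nsmul_eq_mul] at h1
    have hB : 0 ≤ 125 / 6 * δ⁻¹ ^ 6 + |e| := by positivity
    nlinarith [hcompl, hB]
  -- a non-layered site is a non-layered site of `Ω` or a shallow site
  have hsplit : ((Finset.univ.filter fun i => ¬ LayeredNear η x i).card : ℝ) ≤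
      ((Ω.filter fun i => ¬ LayeredNear η x i).card : ℝ) + (Ωᶜ).card := by
    have hsub : (Finset.univ.filter fun i => ¬ LayeredNear η x i) ⊆
        (Ω.filter fun i => ¬ LayeredNear η x i) ∪ Ωᶜ := by
      intro i hi
      by_cases hio : i ∈ Ω
      · exact Finset.mem_union_left _ (Finset.mem_filter.2 ⟨hio, (Finset.mem_filter.1 hi).2⟩)
      · exact Finset.mem_union_right _ (Finset.mem_compl.2 hio)
    calc ((Finset.univ.filter fun i => ¬ LayeredNear η x i).card : ℝ)
        ≤ (((Ω.filter fun i => ¬ LayeredNear η x i) ∪ Ωᶜ).card : ℝ) := by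
          exact_mod_cast Finset.card_le_card hsub
      _ ≤ _ := by exact_mod_cast Finset.card_union_le _ _
  have hΩN : (Ω.card : ℝ) ≤ N := by
    have := Finset.card_le_univ Ω
    rw [Fintype.card_fin] at this
    exact_mod_cast this
  have hCmax : C * ((Ω.filter fun i => ∃ j : Fin N, j ∉ Ω ∧ dist (x j) (x i) ≤ ρ).card : ℝ) ≤
      max C 0 * (M * (M * D.card)) :=
    calc C * ((Ω.filter fun i => ∃ j : Fin N, j ∉ Ω ∧ dist (x j) (x i) ≤ ρ).card : ℝ)
        ≤ max C 0 * ((Ω.filter fun i => ∃ j : Fin N, j ∉ Ω ∧ dist (x j) (x i) ≤ ρ).card : ℝ) :=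
          mul_le_mul_of_nonneg_right (le_max_left _ _) (by positivity)
      _ ≤ max C 0 * (M * (M * D.card)) := mul_le_mul_of_nonneg_left hbdry (le_max_right _ _)
  have hθN : θ * (Ω.card : ℝ) ≤ θ * N := mul_le_mul_of_nonneg_left hΩN hθ
  have h5 : c * ((Finset.univ.filter fun i => ¬ LayeredNear η x i).card : ℝ) ≤
      c * ((Ω.filter fun i => ¬ LayeredNear η x i).card : ℝ) + c * (M * D.card) := by
    have := mul_le_mul_of_nonneg_left hsplit hc.le
    have := mul_le_mul_of_nonneg_left hcompl hc.le
    linarith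
  have hfinal : c * ((Finset.univ.filter fun i => ¬ LayeredNear η x i).card : ℝ) ≤
      (∑ i, ((1 / 2 : ℝ) * siteEnergy lennardJones x i - e)) + θ * N +
        ((125 / 6 * δ⁻¹ ^ 6 + |e|) * (M * D.card) + max C 0 * (M * (M * D.card)) +
          c * (M * D.card)) := by
    linarith
  calc c * ((Finset.univ.filter fun i => ¬ LayeredNear η x i).card : ℝ) ≤ _ := hfinal
    _ = _ := by ring

/-- **The squeeze, per ground-state sequence**: under `SplitCoercivity`, if the defect fraction tends to
`0` then for every `η > 0` the fraction of sites whose 2-ball is not `η`-layered tends to `0` (the charge `c(η)`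
does not depend on the slack `θ`, which is sent to `0` AFTER `N → ∞`; minimality enters through the `o(N)`
budget `squeeze_tendsto_sum_excess_div` and `1/3`-separation `LennardJonesMinimalDistance_holds`). -/
theorem squeeze_tendsto_card_not_layeredNear_div (hSC : SplitCoercivity) (x : (N : ℕ) → (Fin N → E3))
    (hgs : ∀ N, IsGroundState lennardJones (x N))
    (hdef : Tendsto (fun N : ℕ => (defects (x N) : ℝ) / N) atTop (𝓝 0)) {η : ℝ} (hη : 0 < η) :
    Tendsto (fun N : ℕ => ((Finset.univ.filter fun i => ¬ LayeredNear η (x N) i).card : ℝ) / N)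
      atTop (𝓝 0) := by
  obtain ⟨δ, hδ, hsepall⟩ := LennardJonesMinimalDistance_holds
  obtain ⟨c, hc, hcθ⟩ := hSC δ hδ η hη
  have hbudget := squeeze_tendsto_sum_excess_div x hgs
  rw [Metric.tendsto_atTop]
  intro ε hε
  obtain ⟨ρ, C, hρ, hmain⟩ := hcθ (c * ε / 4) (by positivity)
  set K : ℝ := (2 * ρ / δ + 1) ^ 3 * (max C 0 * (2 * ρ / δ + 1) ^ 3 +
    (125 / 6 * δ⁻¹ ^ 6 + |ChargedEnergyGapNegative.eStar|) + c) with hK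
  have h1 : ∀ᶠ N : ℕ in atTop, (∑ i, ((1 / 2 : ℝ) * siteEnergy lennardJones (x N) i -
      ChargedEnergyGapNegative.eStar)) / N < c * ε / 4 :=
    hbudget.eventually_lt_const (by positivity)
  have h2 : ∀ᶠ N : ℕ in atTop, K * ((defects (x N) : ℝ) / N) < c * ε / 4 := by
    have h := hdef.const_mul K
    rw [mul_zero] at h
    exact h.eventually_lt_const (by positivity)
  obtain ⟨N₀, hN₀⟩ := eventually_atTop.1 (h1.and (h2.and (eventually_ge_atTop 1)))
  refine ⟨N₀, fun N hN => ?_⟩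
  obtain ⟨hN1, hN2, hN3⟩ := hN₀ N hN
  have hsep := hsepall N (x N) (hgs N)
  have key := squeeze_ineq hδ hρ hc (by positivity : (0 : ℝ) ≤ c * ε / 4) hsep
    (hmain N (x N) hsep)
  rw [← squeeze_defects_eq_card_filter] at key
  have hNpos : (0 : ℝ) < N := by exact_mod_cast hN3
  rw [Real.dist_eq, sub_zero, abs_of_nonneg (by positivity), div_lt_iff₀ hNpos]
  have hS : (∑ i, ((1 / 2 : ℝ) * siteEnergy lennardJones (x N) i -
      ChargedEnergyGapNegative.eStar)) < c * ε / 4 * N := by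
    rwa [div_lt_iff₀ hNpos] at hN1
  have hD : K * (defects (x N) : ℝ) < c * ε / 4 * N := by
    rw [← mul_div_assoc, div_lt_iff₀ hNpos] at hN2
    exact hN2
  have hlt : c * ((Finset.univ.filter fun i => ¬ LayeredNear η (x N) i).card : ℝ) <
      c * (ε * N) := by
    have : K * (defects (x N) : ℝ) = (2 * ρ / δ + 1) ^ 3 * (max C 0 * (2 * ρ / δ + 1) ^ 3 +
        (125 / 6 * δ⁻¹ ^ 6 + |ChargedEnergyGapNegative.eStar|) + c) * (defects (x N) : ℝ) := by
      rw [hK]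
    nlinarith
  exact lt_of_mul_lt_mul_left hlt hc.le

end Squeeze

/-- **Anchor of part A (registered stub `squeeze_budget_anchor`)**: the `o(N)` energy budget of a
Lennard-Jones ground-state sequence, `(E(x N) − N·⨅_Q e(Q))/N → 0` (= `squeeze_tendsto_excess_div`). -/
theorem squeeze_budget_anchor :
    ∀ x : (N : ℕ) → (Fin N → EuclideanSpace ℝ (Fin 3)), (∀ N, IsGroundState lennardJones (x N)) →
      Tendsto (fun N : ℕ => (interactionEnergy lennardJones (x N) -
        (N : ℝ) * (⨅ Q : PeriodicConfiguration 3, Q.energyPerParticle lennardJones)) / N) atTop (𝓝 0) :=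
  squeeze_tendsto_excess_div

end Summit.AtomisticToContinuum.Crystallization.Theorems.PrestressSplitKorn

end
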